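import Literature.AlgebraicGeometry.Motives.AbelianVarietyPrincipalPolarization
import Literature.AlgebraicGeometry.Motives.AbelianVarietyWeilPairingDivisorClass
import Literature.AlgebraicGeometry.Motives.AbelianVarietyTorsionPointsCountProofs
import HarnessLib

/-!
# A principal polarization divisor is not a proper multiple: `A[n] ≤ K(n • Θ)`, hence `K(n • Θ) = 0 ⟹ n = 1`

Layer `Literature/AlgebraicGeometry/Motives`, namespace `Literature.AlgebraicGeometry.Motives.AbelianVariety`.
THEOREMS ONLY (no definition, no named fact, no instance, no `sorry`).

For an abelian variety `A` over a field `K`, a Cartier divisor `Θ` on `A` and `n : ℕ`, the divisor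
`D_Q^{nΘ} = t_Q^*(nΘ) - nΘ` of the multiple `n • Θ` is `n • D_Q^{Θ}` (`weilDiv_smul_linEquiv`), so by the
theorem of the square (`φ_Θ(Qⁿ) = n φ_Θ(Q)`, the tree's `nsmul_weilDiv_linEquiv_zero`) every `n`-torsion
point lies in Mumford's group `K(n • Θ) = ker φ_{nΘ}` (`torsionPoints_le_KTheta_smul`: **`A[n](K) ≤ K(n • Θ)(K)`**,
Mumford §6 Cor. 4 with §8 (iv) `φ_{Lⁿ} = n φ_L`). Over an algebraically closed field in which `n` is
invertible, `#A[n](K) = n^{2 dim A}` (Mumford §6 App. 3, the tree's theorem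
`natCard_torsionPoints_eq_of_isAlgClosed`), so for `dim A ≥ 1` the group `K(n • Θ)(K)` can only be trivial when
`n = 1` (`eq_one_of_KTheta_smul_eq_bot`). In particular **a principal polarization divisor
(`IsPrincipalPolarizationDivisor`: ample with `K(Θ) = 0`, Lange §2.1.1 / Prop. 1.4.7) is never linearly
equivalent to a proper multiple `n • Θ₀`, `n ≥ 2`** (`IsPrincipalPolarizationDivisor.eq_one_of_smul`,
`IsPrincipalPolarizationDivisor.eq_one_of_linEquiv_smul`; ampleness is not used). Also recorded: `K(Θ)` depends
only on the linear equivalence class of `Θ` (`KTheta_congr_linEquiv`, from ★ `weilDiv_congr_linEquiv`) and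
`K(Θ) ≤ K(n • Θ)` (`KTheta_le_KTheta_smul`).

This is leaf (iii) of the cell's «(Θ-uniq)» chain — letters `torsionPoints_le_KTheta_smul` and
`eq_one_of_isPrincipalPolarizationDivisor_smul` of the G3 socket file (two principal Riemann theta divisors of one complex
Jacobian have equal level pairings ⟸ irreducibility of `W̃_{g-1}` + multiplicity + THIS + translation invariance of `ē`).
Count-neutral; HC_CM is proved only modulo the 7 printed citations until rung 0 closes.

## References
* [MumfordAV1970] D. Mumford, *Abelian Varieties* (1970): §6 Cor. 4 (p. 59) and Application 3 (Proposition
  p. 64); §8 (`φ_L`, `K(L)`, property (iv) `φ_{L^n} = n φ_L`).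
* [Lange2023AbelianVarietiesComplex] H. Lange, *Abelian Varieties over the Complex Numbers* (2023): §1.4.2
  Prop. 1.4.7 (`deg φ_L = #K(L)`), §2.1.1 (p. 68: principal polarization), §2.1.2 Cor. 2.1.8.
-/

universe u

open CategoryTheory CategoryTheory.Limits AlgebraicGeometry MonoidalCategory CartesianMonoidalCategory

noncomputable section

namespace Literature.AlgebraicGeometry.Motives

open scoped MonObj

namespace AbelianVariety

variable {K : Type u} [Field K] (A : AbelianVariety K)

/-! ### `D_Q` of a multiple -/

/-- **`D_Q^{mD} ∼ m • D_Q^{D}`**: `t_Q^*(m • D) - m • D = m • (t_Q^* D - D)` in the divisor class group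
(`g^*(m • D) = m • g^* D` on the nose, and the class map is additive). [cite: MumfordAV1970, §8 (property (iv) of φ_L)] -/
theorem weilDiv_smul_linEquiv (D : CartierDivisor A.X.left) (Q : A.Points K) (m : ℕ) :
    (A.weilDiv (m • D) Q).LinEquiv (m • A.weilDiv D Q) := by
  obtain ⟨Qc, _, cl, hadd, heq⟩ := CartierDivisor.exists_classMap A.X.left
  apply (heq _ _).2
  have h1 : cl (A.weilDiv (m • D) Q) = m • (cl (D.pullback (A.translation Q).left) - cl D) := by
    rw [classMap_weilDiv hadd heq, CartierDivisor.pullback_smul, CartierDivisor.classMap_smul hadd heq,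
      CartierDivisor.classMap_smul hadd heq, smul_sub]
  have h2 : cl (m • A.weilDiv D Q) = m • (cl (D.pullback (A.translation Q).left) - cl D) := by
    rw [CartierDivisor.classMap_smul hadd heq, classMap_weilDiv hadd heq]
  rw [h1, h2]

/-! ### `K(D)`: class invariance and multiples -/

/-- **`K(D) = K(D')` for `D ∼ D'`** — Mumford's `K(L)` depends only on the isomorphism class of `L = 𝒪(D)`
(★ `weilDiv_congr_linEquiv`). [cite: MumfordAV1970, §6 Definition (p. 60) and §8] -/
theorem KTheta_congr_linEquiv {D D' : CartierDivisor A.X.left} (H : D.LinEquiv D') :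
    A.KTheta D = A.KTheta D' := by
  ext P
  rw [mem_KTheta_iff, mem_KTheta_iff]
  exact ⟨fun hP => (A.weilDiv_congr_linEquiv H P).symm.trans hP,
    fun hP => (A.weilDiv_congr_linEquiv H P).trans hP⟩

/-- **`K(D) ≤ K(m • D)`**: if `D_P^{D} ∼ 0` then `D_P^{mD} ∼ m • D_P^{D} ∼ 0`.
[cite: MumfordAV1970, §8 (property (iv) of φ_L)] -/
theorem KTheta_le_KTheta_smul (D : CartierDivisor A.X.left) (m : ℕ) :
    A.KTheta D ≤ A.KTheta (m • D) := by
  intro P hP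
  rw [mem_KTheta_iff] at hP ⊢
  obtain ⟨Qc, _, cl, hadd, heq⟩ := CartierDivisor.exists_classMap A.X.left
  refine (A.weilDiv_smul_linEquiv D P m).trans ((heq _ _).2 ?_)
  rw [CartierDivisor.classMap_smul hadd heq, (heq _ _).1 hP, CartierDivisor.classMap_zero hadd heq, smul_zero]

/-- **`A[m](K) ≤ K(m • D)(K)`** (G3 letter (iii-a), any field, any `D`) — every `m`-torsion rational point `Q`
satisfies `t_Q^*(mD) ∼ mD`: `D_Q^{mD} ∼ m • D_Q^{D}` (`weilDiv_smul_linEquiv`) and by the theorem of the square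
`m • D_Q ∼ D_{Q^m} = D_1 ∼ 0` (★ `nsmul_weilDiv_linEquiv_zero`); i.e. `A[m] ⊆ ker (m φ_D) = ker φ_{D^m}`.
[cite: MumfordAV1970, §6 Cor. 4 (p. 59)] [cite: MumfordAV1970, §8 (property (iv) of φ_L)] -/
theorem torsionPoints_le_KTheta_smul (D : CartierDivisor A.X.left) (m : ℕ) :
    A.torsionPoints K (m : ℤ) ≤ A.KTheta (m • D) := by
  intro Q hQ
  rw [mem_torsionPoints_iff, zpow_natCast] at hQ
  rw [mem_KTheta_iff]
  exact (A.weilDiv_smul_linEquiv D Q m).trans (A.nsmul_weilDiv_linEquiv_zero D hQ)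

/-! ### `K(m • D) = 0` forces `m = 1` -/

/-- **`K(m • D)(K) = 0 ⟹ m = 1`** over an algebraically closed field `K` in which `m` is invertible, for
`dim A ≥ 1`: `A[m](K) ≤ K(m • D)(K) = 0` forces `#A[m](K) = m ^ (2 dim A)` (Mumford §6 App. 3, the tree's
★ `natCard_torsionPoints_eq_of_isAlgClosed`) to be `1`. Ampleness of `D` is not used.
[cite: MumfordAV1970, §6 Application 3 (Proposition p. 64)] [cite: MumfordAV1970, §6 Cor. 4 (p. 59)] -/
theorem eq_one_of_KTheta_smul_eq_bot [IsAlgClosed K] (hA : 0 < A.dim) {D : CartierDivisor A.X.left} {m : ℕ}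
    (hm : (m : K) ≠ 0) (h : A.KTheta (m • D) = ⊥) : m = 1 := by
  have hle : A.torsionPoints K (m : ℤ) ≤ ⊥ := by
    rw [← h]
    exact A.torsionPoints_le_KTheta_smul D m
  have hcard : Nat.card (A.torsionPoints K (m : ℤ)) = 1 := by
    rw [le_bot_iff.1 hle]
    exact Subgroup.card_bot
  have hcount := natCard_torsionPoints_eq_of_isAlgClosed A K (m : ℤ) (by exact_mod_cast hm)
  rw [hcard, Int.natAbs_natCast] at hcount
  have h2 : 2 * A.dim ≠ 0 := by omega
  rcases Nat.pow_eq_one.1 hcount.symm with h1 | h1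
  · exact h1
  · exact absurd h1 h2

/-- **`K(m • D)(K) = 0 ⟹ m = 1` in characteristic zero** (e.g. over `ℂ`), for `m ≠ 0` and `dim A ≥ 1`.
[cite: MumfordAV1970, §6 Application 3 (Proposition p. 64)] -/
theorem eq_one_of_KTheta_smul_eq_bot_of_charZero [IsAlgClosed K] [CharZero K] (hA : 0 < A.dim)
    {D : CartierDivisor A.X.left} {m : ℕ} (hm : m ≠ 0) (h : A.KTheta (m • D) = ⊥) : m = 1 :=
  A.eq_one_of_KTheta_smul_eq_bot hA (by exact_mod_cast hm) h

variable {A}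

/-- **A principal polarization divisor of the form `m • D` has `m = 1`** (`K` algebraically closed, `m` invertible
in `K`, `dim A ≥ 1`): `K(m • D) = 0` (Lange §2.1.1: principal ⟺ `K(L) = 0`, Prop. 1.4.7) contains `A[m]`.
[cite: Lange2023AbelianVarietiesComplex, §2.1.1 (p. 68) and §1.4.2 Prop. 1.4.7] [cite: MumfordAV1970, §6 Application 3 (Proposition p. 64)] -/
theorem IsPrincipalPolarizationDivisor.eq_one_of_smul [IsAlgClosed K] (hA : 0 < A.dim)
    {D : CartierDivisor A.X.left} {m : ℕ} (hm : (m : K) ≠ 0) (h : A.IsPrincipalPolarizationDivisor (m • D)) :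
    m = 1 :=
  A.eq_one_of_KTheta_smul_eq_bot hA hm h.KTheta_eq_bot

/-- **G3 letter (iii-b), over `ℂ`: a principal polarization divisor of the form `m • D` on an abelian variety of
positive dimension has `m = 1`** (`A[m](ℂ) ≤ K(m • D) = ⊥` and `#A[m](ℂ) = m^{2 dim A}`).
[cite: Lange2023AbelianVarietiesComplex, §2.1.1 (p. 68) and §1.4.2 Prop. 1.4.7] [cite: MumfordAV1970, §6 Application 3 (Proposition p. 64)] -/
theorem eq_one_of_isPrincipalPolarizationDivisor_smul (A : AbelianVariety ℂ) (hA : 1 ≤ A.dim)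
    (D : CartierDivisor A.X.left) {m : ℕ} (hm : m ≠ 0) (h : A.IsPrincipalPolarizationDivisor (m • D)) :
    m = 1 :=
  h.eq_one_of_smul (Nat.lt_of_lt_of_le Nat.zero_lt_one hA) (by exact_mod_cast hm)

/-- **A principal polarization divisor is not linearly equivalent to a proper multiple**: if `D'` is a principal
polarization divisor and `D' ∼ m • D` then `m = 1` (`K` algebraically closed, `m` invertible in `K`, `dim A ≥ 1`;
`K(D') = K(m • D)` by class invariance). The shape consumed by the «(Θ-uniq)» chain after the multiplicity step
(`Θ₁ ≈ m • D_S` with `S` the irreducible support).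
[cite: Lange2023AbelianVarietiesComplex, §2.1.1 (p. 68) and §2.1.2 Cor. 2.1.8] [cite: MumfordAV1970, §6 Application 3 (Proposition p. 64)] -/
theorem IsPrincipalPolarizationDivisor.eq_one_of_linEquiv_smul [IsAlgClosed K] (hA : 0 < A.dim)
    {D D' : CartierDivisor A.X.left} {m : ℕ} (hm : (m : K) ≠ 0) (h : A.IsPrincipalPolarizationDivisor D')
    (H : D'.LinEquiv (m • D)) : m = 1 := by
  have hK := h.KTheta_eq_bot
  rw [A.KTheta_congr_linEquiv H] at hK
  exact A.eq_one_of_KTheta_smul_eq_bot hA hm hK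

/-- The same over an algebraically closed field of characteristic zero (e.g. `ℂ`), with the side condition `m ≠ 0`;
also for `SameDivisor` inputs via `SameDivisor.linEquiv`. [cite: Lange2023AbelianVarietiesComplex, §2.1.2 Cor. 2.1.8] -/
theorem IsPrincipalPolarizationDivisor.eq_one_of_linEquiv_smul_of_charZero [IsAlgClosed K] [CharZero K]
    (hA : 0 < A.dim) {D D' : CartierDivisor A.X.left} {m : ℕ} (hm : m ≠ 0)
    (h : A.IsPrincipalPolarizationDivisor D') (H : D'.LinEquiv (m • D)) : m = 1 :=
  h.eq_one_of_linEquiv_smul hA (by exact_mod_cast hm) H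

end AbelianVariety

end Literature.AlgebraicGeometry.Motives

end
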